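import Mathlib
import HarnessLib
import Summits.Ventures.LatticeQCDFlow.Exactness.SphereFlowLiouvilleMeasure
import Summits.Ventures.LatticeQCDFlow.Exactness.SphereFlowJacobianCocycle

/-!
# The law of the flowed configuration: `(Φ_{s→c})_*π̄ = e^{ℓ_{c→s}}·π̄` — the density of the transported a-priori measure is the Jacobian of the INVERSE evolution map, `exp(∫_s^c Σ_n∂̃_n·∂̃_nG_u(Φ_{c→u}ω) du)`

HONEST FRAMING: exact (Metropolis-corrected) sampling algorithms for lattice gauge theory;
figures of merit are autocorrelation/cost numbers at stated couplings and volumes; no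
continuum-physics claim.

Venture `LatticeQCDFlow` (cell pub-lqcd), topic `Exactness`; FANOUT row 7 (`s0-cpn-null`: the
S0-D1 rung — 2D CP⁹, Lüscher's LO trivializing map inside HMC, Engel–Schaefer 2011).  NEW WORK of
the cell over the tree's `Exactness/SphereFlowLiouvilleMeasure.lean` (this leg: Liouville's theorem
`(Φ_{s→c})_*(e^{ℓ_{s→c}}π̄) = π̄`, tilting by continuous exponents) and
`Exactness/SphereFlowJacobianCocycle.lean` (this leg: `ℓ_{c→s}(Φ_{s→c}x) = −ℓ_{s→c}(x)`); nothing is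
cited as a fact.  Printed counterpart, NAMED ONLY: M. Lüscher, Commun. Math. Phys. 293 (2010) 899,
§3 (3.4)–(3.8) (the density of the pulled-back / pushed-forward measure is the Jacobian).

GEN-13/GEN-14 asked for "the push-forward of `π̄` under the flow map".  GEN-14 answered it WHEN the
flow equation holds (`(Φ_{0→c})_*π̄ = e^{−cS}π̄/Z_c`).  THIS FILE answers it for EVERY jointly `C³`
generator, in closed form:

* **`integral_comp_sphereTDFlow_eq_integral_exp_logJac_mul`** — for `|s|, |c| ≤ |T| + 1` and every
  `C¹` observable, `∫ H(Φ_{s→c}ω) dπ̄(ω) = ∫ e^{ℓ_{c→s}(ω)}·H(ω) dπ̄(ω)`: the law of the flowed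
  uniform configuration has density `e^{ℓ_{c→s}}` — the Jacobian of the inverse map `Φ_{c→s}`,
  `ℓ_{c→s}(ω) = −∫_c^s Σ_n∂̃²_nG_u(Φ_{c→u}ω)du = ∫_s^c Σ_n∂̃²_nG_u(Φ_{c→u}ω)du` (apply Liouville to
  the `C¹` observable `H·e^{ℓ_{c→s}}` and use `ℓ_{c→s}∘Φ_{s→c} = −ℓ_{s→c}`);
* **`map_sphereTDFlowMap_spherePi_eq_tilted_logJac`** — as probability measures on `Ω`:
  `(Φ_{s→c})_*π̄ = π̄.tilted ℓ_{c→s}` (`∫e^{ℓ_{c→s}}dπ̄ = 1`, so the tilt is the plain density);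
* **`integral_comp_sphereTDFlow_eq_tiltedMean_iff`**-type remark in words: comparing with GEN-14's
  `luscher_trivialization`, the flow equation on `[s, c]` is exactly the statement that this density
  is `e^{−cS}/Z_c` when `s = 0` — here no equation is assumed and the density is what it is.

NOT CLAIMED: pointwise identification of `e^{ℓ_{c→s}}` with a chart determinant; generators only
jointly `C²`; anything quantitative, about autocorrelations or the rung's numbers.
-/

noncomputable section

namespace Summit.Ventures.LatticeQCDFlow.Exactness

open Function Set Metric MeasureTheory NormedSpace InnerProductSpace
open scoped RealInnerProductSpace Topology

variable {Λ : Type*} {E : Type*} [NormedAddCommGroup E] [InnerProductSpace ℝ E]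
  [FiniteDimensional ℝ E] [Fintype Λ] [DecidableEq Λ] [MeasurableSpace E] [BorelSpace E]
  [Nontrivial E] {G : ℝ → (Λ → E) → ℝ} {T : ℝ}

/-- **THE LAW OF THE FLOWED UNIFORM CONFIGURATION.**  For a jointly `C³` generator,
`|s|, |c| ≤ |T| + 1` and every `C¹` observable `H`:
`∫ H(Φ_{s→c}ω) dπ̄(ω) = ∫ e^{ℓ_{c→s}(ω)}·H(ω) dπ̄(ω)` — the push-forward of the a-priori product
measure under the evolution map `Φ_{s→c}` has density `e^{ℓ_{c→s}}`, the Jacobian of the inverse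
evolution map (Liouville's theorem applied to `H·e^{ℓ_{c→s}}`, and `ℓ_{c→s}(Φ_{s→c}ω) = −ℓ_{s→c}(ω)`). -/
theorem integral_comp_sphereTDFlow_eq_integral_exp_logJac_mul
    (hG : ContDiff ℝ 2 fun q : ℝ × (Λ → E) => G q.1 q.2)
    (hG3 : ContDiff ℝ 3 fun q : ℝ × (Λ → E) => G q.1 q.2) {H : (Λ → E) → ℝ} (hH : ContDiff ℝ 1 H)
    {s c : ℝ} (hs : |s| ≤ |T| + 1) (hc : |c| ≤ |T| + 1) :
    ∫ ω, H (sphereTDFlow hG T s c (fun m => ((ω : Λ → sphere (0 : E) 1) m : E)))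
        ∂Measure.pi (fun _ : Λ => uniformSphere (volume : Measure E)) =
      ∫ ω, Real.exp (sphereTDFlowLogJac hG T c s (fun m => ((ω : Λ → sphere (0 : E) 1) m : E))) *
        H (fun m => (ω m : E)) ∂Measure.pi (fun _ : Λ => uniformSphere (volume : Measure E)) := by
  -- Liouville for the `C¹` observable `z ↦ e^{ℓ_{c→s}(z)}·H(z)`
  have hK : ContDiff ℝ 1 fun z : Λ → E => Real.exp (sphereTDFlowLogJac hG T c s z) * H z :=
    (contDiff_sphereTDFlowLogJac_apply hG hG3 c s (T := T)).exp.mul hH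
  have h := integral_exp_sphereTDFlowLogJac_mul_comp_sphereTDFlow hG hG3 hK hs hc (T := T)
  rw [← h]
  refine integral_congr_ae (ae_of_all _ fun ω => ?_)
  simp only [sphereTDFlowLogJac_symm hG hG3 s c, Real.exp_neg]
  have hpos : Real.exp (sphereTDFlowLogJac hG T s c (fun m => ((ω : Λ → sphere (0 : E) 1) m : E))) ≠ 0 :=
    (Real.exp_pos _).ne'
  field_simp

/-- The same with the cut-off removed from the density: for `|s|, |c| ≤ |T| + 1`,
`∫ H(Φ_{s→c}ω) dπ̄ = ∫ exp(∫_s^c Σ_n∂̃_n·∂̃_nG_u(Φ_{c→u}ω) du)·H(ω) dπ̄`. -/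
theorem integral_comp_sphereTDFlow_eq_integral_exp_intervalIntegral_mul
    (hG : ContDiff ℝ 2 fun q : ℝ × (Λ → E) => G q.1 q.2)
    (hG3 : ContDiff ℝ 3 fun q : ℝ × (Λ → E) => G q.1 q.2) {H : (Λ → E) → ℝ} (hH : ContDiff ℝ 1 H)
    {s c : ℝ} (hs : |s| ≤ |T| + 1) (hc : |c| ≤ |T| + 1) :
    ∫ ω, H (sphereTDFlow hG T s c (fun m => ((ω : Λ → sphere (0 : E) 1) m : E)))
        ∂Measure.pi (fun _ : Λ => uniformSphere (volume : Measure E)) =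
      ∫ ω, Real.exp (∫ u in s..c, ∑ n, siteLaplacian n (G u)
          (sphereTDFlow hG T c u (fun m => ((ω : Λ → sphere (0 : E) 1) m : E)))) *
        H (fun m => (ω m : E)) ∂Measure.pi (fun _ : Λ => uniformSphere (volume : Measure E)) := by
  rw [integral_comp_sphereTDFlow_eq_integral_exp_logJac_mul hG hG3 hH hs hc]
  refine integral_congr_ae (ae_of_all _ fun ω => ?_)
  simp only [sphereTDFlowLogJac_eq_of_norm_eq_one hG c s (norm_sphereConfig_eq_one ω),
    intervalIntegral.integral_symm s c, neg_neg]

/-- **THE LAW OF THE FLOWED UNIFORM CONFIGURATION AS A MEASURE ON `Ω`**: for a jointly `C³`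
generator and `|s|, |c| ≤ |T| + 1`, `(Φ_{s→c})_*π̄ = π̄.tilted ℓ_{c→s}` — a probability density
(`∫e^{ℓ_{c→s}}dπ̄ = 1`), the Jacobian of the inverse evolution map. -/
theorem map_sphereTDFlowMap_spherePi_eq_tilted_logJac
    (hG : ContDiff ℝ 2 fun q : ℝ × (Λ → E) => G q.1 q.2)
    (hG3 : ContDiff ℝ 3 fun q : ℝ × (Λ → E) => G q.1 q.2) {s c : ℝ} (hs : |s| ≤ |T| + 1)
    (hc : |c| ≤ |T| + 1) :
    Measure.map (sphereTDFlowMap hG T s c) (Measure.pi (fun _ : Λ => uniformSphere (volume : Measure E))) =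
      (Measure.pi (fun _ : Λ => uniformSphere (volume : Measure E))).tilted
        fun ω => sphereTDFlowLogJac hG T c s (fun m => (ω m : E)) := by
  haveI := isProbabilityMeasure_spherePi_tilted
    (continuous_sphereTDFlowLogJac_sphereConfig hG hG3 c s (T := T))
  haveI : IsProbabilityMeasure (Measure.map (sphereTDFlowMap hG T s c)
      (Measure.pi (fun _ : Λ => uniformSphere (volume : Measure E)))) :=
    Measure.isProbabilityMeasure_map (measurable_sphereTDFlowMap hG T s c).aemeasurable
  refine measure_sphereConfig_ext_of_forall_integral_contDiff_eq fun H hH => ?_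
  have hcH : Continuous fun ω : Λ → sphere (0 : E) 1 => H (fun n => (ω n : E)) :=
    hH.continuous.comp continuous_sphereConfig
  rw [integral_map (measurable_sphereTDFlowMap hG T s c).aemeasurable hcH.aestronglyMeasurable]
  simp only [coe_sphereTDFlowMap_eq]
  rw [integral_spherePi_tilted, integral_exp_sphereTDFlowLogJac hG hG3 hc hs, div_one,
    integral_comp_sphereTDFlow_eq_integral_exp_logJac_mul hG hG3 hH hs hc]

/-- **From time `0`**: the flowed uniform configuration `Φ_{0→c}(ω)`, `ω ∼ π̄`, `|c| ≤ |T| + 1`, has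
law `π̄.tilted ℓ_{c→0}` with `ℓ_{c→0}(ω) = ∫_0^c Σ_n∂̃²_nG_u(Φ_{c→u}ω) du` on `Ω` — to be compared with
GEN-14's `luscher_trivialization`: the flow equation on `[0, c]` is precisely the condition that this
density be `e^{−cS}/Z_c`. -/
theorem map_sphereTDFlowMap_zero_spherePi_eq_tilted_logJac
    (hG : ContDiff ℝ 2 fun q : ℝ × (Λ → E) => G q.1 q.2)
    (hG3 : ContDiff ℝ 3 fun q : ℝ × (Λ → E) => G q.1 q.2) {c : ℝ} (hc : |c| ≤ |T| + 1) :
    Measure.map (sphereTDFlowMap hG T 0 c) (Measure.pi (fun _ : Λ => uniformSphere (volume : Measure E))) =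
      (Measure.pi (fun _ : Λ => uniformSphere (volume : Measure E))).tilted
        fun ω => sphereTDFlowLogJac hG T c 0 (fun m => (ω m : E)) :=
  map_sphereTDFlowMap_spherePi_eq_tilted_logJac hG hG3 (by rw [abs_zero]; positivity) hc

end Summit.Ventures.LatticeQCDFlow.Exactness

end
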